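import Mathlib
import Summits.MatrixMultiplication.MatrixMultiplication.Theses.FidelityWitnesses
import Literature.Computability.AlgebraicComplexity.AsymptoticRankConjecture
import Literature.Computability.AlgebraicComplexity.AsymptoticRankMatMul
import Literature.Computability.AlgebraicComplexity.TensorRestrictionRank
import Literature.Computability.AlgebraicComplexity.FlatteningBound
import Literature.Barriers.MatrixMultiplication.UniversalMethodBarrierAsymptoticRank

/-!
# `FidelityWitnesses.FidelityThesis` (stmt-MatrixMultiplication-4956) — Negative lane, III:
# the asymptotic rank conjecture kills the crux

The crux is a refutation line's target (`FidelityThesis ⟺ ω(ℂ) > 2`, parts I–II), so every printed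
conjecture implying `ω = 2` refutes it.  The strongest such conjecture registered in the tree is the
ASYMPTOTIC RANK CONJECTURE `BCS1997_problem155_negative` (BCS 1997, Problem 15.5, negative answer =
CGLVW 2021, Question 1.7: every tensor of format `(m,n,p)` has `R̃(t) ≤ max{m,n,p}`).  Applied to
`⟨2,2,2⟩` reindexed to format `4 × 4 × 4` it gives `2^ω ≤ R̃(⟨2,2,2⟩) ≤ 4`, i.e. `ω(ℂ) ≤ 2`, hence
`ω(ℂ) = 2` and `¬ FidelityThesis` by the route's own deciding theorem `closes`.  No Theses statement is
asserted positively; the refutation is CONDITIONAL on a registered open conjecture (settles nothing).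
-/

namespace Summit.MatrixMultiplication.MatrixMultiplication.Theorems

open scoped BigOperators
open Literature.Computability.AlgebraicComplexity
open Literature.Barriers.MatrixMultiplication (asymptoticRank_le_of_polyDegeneratesTo)
open Summit.MatrixMultiplication.MatrixMultiplication.Theses.FidelityWitnesses (FidelityThesis closes)

/-- **The asymptotic rank conjecture implies `ω(ℂ) ≤ 2`**: `BCS1997_problem155_negative ℂ` (BCS 1997,
Problem 15.5, negative answer; = CGLVW 2021 Question 1.7) applied to `⟨2,2,2⟩` reindexed to the format
`4 × 4 × 4` gives `2^ω ≤ R̃(⟨2,2,2⟩) ≤ 4` (`rpow_omega_le_asymptoticRank_matMulTensor`, monotonicity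
of `R̃` under restriction, `tensorRestrictsTo_of_reindex`).
[cite: BurgisserClausenShokrollahi1997, Problem 15.5 (p. 420)] -/
theorem fidelityThesis_omega_le_two_of_asymptoticRankConjecture (h : BCS1997_problem155_negative ℂ) :
    omega ℂ ≤ 2 := by
  set e : Fin 4 ≃ Fin 2 × Fin 2 := (finCongr (show 4 = 2 * 2 by norm_num)).trans finProdFinEquiv.symm
    with he
  set t' : Fin 4 → Fin 4 → Fin 4 → ℂ := fun a b c => matMulTensor ℂ 2 2 2 (e a) (e b) (e c) with ht'
  have hres : TensorRestrictsTo t' (matMulTensor ℂ 2 2 2) := tensorRestrictsTo_of_reindex _ e e e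
  have h1 : asymptoticRank (matMulTensor ℂ 2 2 2) ≤ asymptoticRank t' :=
    asymptoticRank_le_of_polyDegeneratesTo hres.polyDegeneratesTo
  have h2 : asymptoticRank t' ≤ 4 := by simpa using h 4 4 4 t'
  have h3 : (2 : ℝ) ^ omega ℂ ≤ asymptoticRank (matMulTensor ℂ 2 2 2) := by
    simpa using rpow_omega_le_asymptoticRank_matMulTensor ℂ 2
  have h4 : (2 : ℝ) ^ omega ℂ ≤ (2 : ℝ) ^ (2 : ℝ) := by
    rw [Real.rpow_two]; norm_num; linarith
  exact (Real.rpow_le_rpow_left_iff (by norm_num : (1 : ℝ) < 2)).1 h4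

/-- **The crux contradicts the asymptotic rank conjecture** (`ARC → ¬ FidelityThesis`): a negative
lemma modulo a registered OPEN conjecture (it settles nothing, but prices the crux: proving it refutes
ARC, hence also CGLVW Conj. 1.4–1.6 and every `ω = 2` programme).
[cite: BurgisserClausenShokrollahi1997, Problem 15.5 (p. 420)] -/
theorem fidelityThesis_false_of_asymptoticRankConjecture (h : BCS1997_problem155_negative ℂ) :
    ¬ FidelityThesis := fun hX =>
  closes hX ((MatrixMultiplication_iff).2
    (le_antisymm (fidelityThesis_omega_le_two_of_asymptoticRankConjecture h) (omega_two_le ℂ)))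

end Summit.MatrixMultiplication.MatrixMultiplication.Theorems
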